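import Literature.NumberTheory.EllipticCurves.SelmerLocalConditionGoodReductionProofs
import Literature.NumberTheory.EllipticCurves.CongruenceVisibility
import Literature.NumberTheory.EllipticCurves.IwasawaSelmerControlLocalInputsProofs
import HarnessLib

/-!
# Unramified classes satisfy the local Selmer condition at EVERY place of good reduction — also
# at `v ∣ n` (Milne, *ADT* I Prop. 3.8, the coefficient-`E[n]` corollary without `v ∤ n`)

`Proofs` file (theorems only: no definition, no named fact) in topic `NumberTheory/EllipticCurves`,
companion of `SelmerLocalConditionGoodReductionProofs.lean` (Gross 1991 (7.1): at a good place
`v ∤ n` the local Selmer condition IS "unramified at `v`"). That file proves the inclusion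
`unramifiedKer (E[n]) 𝔓 ≤ selmerLocalKer W K_v n` under `v ∤ n`, the hypothesis being used only to
make a cocycle of an unramified class VANISH on the inertia group (`I_𝔓` fixes `E[n]` when `v ∤ n`).
Milne's Prop. I.3.8 — `H¹(K_v^nr/K_v, E(K_v^nr)) = 0` at good reduction, the tree's discharged
`Milne2006_unramifiedClass_eq_zero_holds` — needs no such hypothesis: a class unramified at `𝔓`
has cocycles `φ` with `φ|_{I_𝔓} = ∂a` for some `a ∈ E[n]`, and `φ − ∂a` is a cocycle of the same
class vanishing on `I_𝔓`. Hence **at every place `v` of good reduction and for every `n`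
(in particular `v ∣ n`): `unramifiedKer (geomTorsion W n) 𝔓 ≤ selmerLocalKer W (v.adicCompletion K) n`**
— the unramified classes satisfy the local Kummer condition (the converse fails at `v ∣ n`: the
Kummer image there is bigger, of order `#E(K_v)[n] · #(𝓞_v/n)`).

Written for the cell `b2b-bsdres` (run/shared/lean/b2b/bsd-rank1-residual/; unit `b2b-bsdres-x10`,
N2 class lead, GEN 22), whose HONEST FRAMING applies to its use there: the goal of that cell is to
DELETE the COMBINATION-SHAPED residual classes for ALL analytic-rank `≤ 1` elliptic curves over `ℚ`,
assembled STRICTLY from published theorems, the CONSTRUCTION-SHAPED remainder being TYPED, not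
attempted; this is not "finishing BSD". Use in the cell: step (S1′) of the UNCONDITIONAL partial
agreement of local Kummer conditions of `p`-congruent curves at a place ABOVE `p` where both are good
(`class-closure/N2/KIND-VIII-SPEC-v2-x10g22.md`): the part of `θ_* 𝓢_v(E′)` that is unramified at
`v` lies in `𝓢_v(E)` with NO named fact (compare the full agreement, Mazur–Rubin 2015, tree
`MazurRubin2015/KummerImageGoodReduction.lean`, a named fact).

* `WeierstrassCurve.unramifiedKer_primeBelow_le_selmerLocalKerOfEmb_of_hasGoodReductionAt` — at the
  prime cut out by an embedding `ι : K̄ → K̄_v`, any `n`;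
* `WeierstrassCurve.unramifiedKer_le_selmerLocalKer_of_hasGoodReductionAt` — any prime `𝔓` above `v`,
  any `n`;
* `WeierstrassCurve.h1Equiv_mem_selmerLocalKer_of_mem_unramifiedKer` — transport: for a
  `Γ_K`-isomorphism `θ : E′[n] ⥲ E[n]` and `E` good at `v`, every class of `H¹(K, E′[n])`
  unramified at a prime above `v` is carried by `θ_*` into `𝓢_v(E)`.

## References

* [MilneADT2006] J. S. Milne, *Arithmetic Duality Theorems*, 2nd ed. (2006), Ch. I Prop. 3.8
  (`H¹(K^un/K, A(K^un)) = 0` at good reduction) and Lemma 3.3.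
* [GrossLMS1991] B. H. Gross, *Kolyvagin's work on modular elliptic curves*, LMS LN 153 (1991), §7 (7.1).
* [NeukirchANT1999] J. Neukirch, *Algebraic Number Theory* (1999), Ch. II §9 Prop. (9.6).
-/

noncomputable section

open scoped Classical Pointwise
open NumberField IsDedekindDomain Field
open Literature.NumberTheory.EllipticCurves Literature.NumberTheory.GaloisRepresentations

universe u

namespace WeierstrassCurve

variable {K : Type u} [Field K] [NumberField K] (W : WeierstrassCurve K) [W.IsElliptic]

/-- **Unramified ⟹ local Selmer condition at ANY good place, at the prime cut out by an embedding**
(Milne, *ADT* I Prop. 3.8: `H¹(K_v^nr/K_v, E(K_v^nr)) = 0` at good reduction). Let `v` be a place of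
good reduction, `n` ANY integer (also `v ∣ n`), `ι : K̄ → K̄_v` a `K`-embedding, `𝔐` a prime of
`\bar 𝓞_v` above `𝓂_v` and `𝔓 = 𝔓_{ι,𝔐}`. A class of `H¹(K, E[n])` unramified at `𝔓` dies in
`H¹(K_v, E)` along `ι`: a cocycle `φ` of it restricts on `I_𝔓` to a coboundary `∂a`, `a ∈ E[n]`
(`oneCocycleClass_mem_subgroupResKer_iff`); the pulled-back local cocycle `σ ↦ ι_* φ(res_ι σ)` minus
the local coboundary of `ι_* a` vanishes on the local inertia group `I_𝔐` (which restricts into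
`I_𝔓`, `resGalOfEmb_mem_inertia_primeBelow`), hence has trivial class by
`Milne2006_unramifiedClass_eq_zero_holds`, and the two local cocycles have the same class.
[cite: MilneADT2006, Ch. I Prop. 3.8] [cite: NeukirchANT1999, Ch. II §9 Prop. (9.6)] -/
theorem unramifiedKer_primeBelow_le_selmerLocalKerOfEmb_of_hasGoodReductionAt
    {v : HeightOneSpectrum (𝓞 K)} (hv : W.HasGoodReductionAt v) (n : ℤ)
    (ι : AlgebraicClosure K →ₐ[K] AlgebraicClosure (v.adicCompletion K))
    {𝔐 : Ideal (v.localAbsIntegers)} (h𝔐 : 𝔐 ∈ v.localPrimesAbove) :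
    unramifiedKer (geomTorsion W n) (v.primeBelow ι 𝔐) ≤
      selmerLocalKerOfEmb W (v.adicCompletion K) ι n := by
  intro c hc
  obtain ⟨φ, rfl⟩ :=
    oneCocycleClass_surjective (discreteTopRep (absoluteGaloisGroup K) (geomTorsion W n)) c
  -- `φ|_{I_𝔓} = ∂a`
  obtain ⟨a, ha⟩ := (oneCocycleClass_mem_subgroupResKer_iff _ φ).mp hc
  unfold selmerLocalKerOfEmb
  rw [mem_resKer_iff, map_oneCocycleClass]
  -- the local point `ι_* a` and its coboundary cocycle on `Γ_{K_v}`
  set A : localPoints W (v.adicCompletion K) := pointsMapOfEmb W ι (a : geomPoints W) with hA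
  set g := contOneCocycles.pullback (resGalOfEmb ι)
    (X := discreteTopRep (absoluteGaloisGroup K) (geomTorsion W n))
    (Y := discreteTopRep (absoluteGaloisGroup (v.adicCompletion K)) (localPoints W (v.adicCompletion K)))
    (resHomOfEquivariant (resGalOfEmb ι) ((pointsMapOfEmb W ι).comp (geomTorsion W n).subtype)
      fun σ P ↦ by
        simp only [AddMonoidHom.coe_comp, AddSubgroup.coe_subtype, Function.comp_apply,
          Literature.NumberTheory.EllipticCurves.AddSubgroup.torsionBy.coe_smul]
        exact pointsMapOfEmb_smul W ι σ P) φ with hg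
  let cob : contOneCocycles (discreteTopRep (absoluteGaloisGroup (v.adicCompletion K))
      (localPoints W (v.adicCompletion K))) :=
    ⟨⟨fun σ ↦ σ • A - A, (continuous_smul_localPoints W _ A).sub continuous_const⟩, fun σ τ ↦ by
      change (σ * τ) • A - A = (σ • A - A) + σ • (τ • A - A)
      rw [mul_smul, smul_sub]; abel⟩
  have hcob : oneCocycleClass _ cob = 0 :=
    (oneCocycleClass_eq_zero_iff _ cob).mpr ⟨A, fun _ ↦ rfl⟩
  -- `g - cob` vanishes on the local inertia group
  have hzero : oneCocycleClass _ (g - cob) = 0 := by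
    refine Milne2006_unramifiedClass_eq_zero_holds W v hv h𝔐 _ fun σ hσ ↦ ?_
    have hres : resGalOfEmb ι σ ∈ (v.primeBelow ι 𝔐).inertia (absoluteGaloisGroup K) :=
      v.resGalOfEmb_mem_inertia_primeBelow ι 𝔐 hσ
    have h1 : φ.1 (resGalOfEmb ι σ) = (resGalOfEmb ι σ) • a - a := ha ⟨_, hres⟩
    change g.1 σ - (σ • A - A) = 0
    rw [hg, contOneCocycles.pullback_apply, h1]
    change pointsMapOfEmb W ι (((resGalOfEmb ι σ) • a - a : geomTorsion W n) : geomPoints W) -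
        (σ • A - A) = 0
    rw [AddSubgroup.coe_sub, map_sub, Literature.NumberTheory.EllipticCurves.AddSubgroup.torsionBy.coe_smul,
      pointsMapOfEmb_smul W ι σ, hA, sub_self]
  have : oneCocycleClass _ g = oneCocycleClass _ (g - cob) + oneCocycleClass _ cob := by
    rw [oneCocycleClass_sub, sub_add_cancel]
  rw [this, hzero, hcob, add_zero]

/-- **Unramified ⟹ local Selmer condition at ANY good place** (Milne, *ADT* I Prop. 3.8). For an
elliptic curve `E/K` over a number field, a finite place `v` of good reduction, ANY `n : ℤ` (also
`v ∣ n`) and any prime `𝔓` of `\bar ℤ_K` above `v`: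
`unramifiedKer (geomTorsion W n) 𝔓 ≤ selmerLocalKer W (v.adicCompletion K) n`. Reduction to the
embedding form: `Γ_K` is transitive on the primes above `v` (`exists_smul_eq_of_mem_primesAbove_holds`),
so `𝔓 = 𝔓_{ι,𝔐}` for `ι = ι₀ ∘ g⁻¹`, and the local kernel does not depend on the embedding
(`selmerLocalKer_eq_of_algHom_holds`) — verbatim the reduction of the `v ∤ n` version.
[cite: MilneADT2006, Ch. I Prop. 3.8] -/
theorem unramifiedKer_le_selmerLocalKer_of_hasGoodReductionAt {v : HeightOneSpectrum (𝓞 K)}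
    (hv : W.HasGoodReductionAt v) (n : ℤ)
    {𝔓 : Ideal (absIntegers (𝓞 K) K)} (h𝔓 : 𝔓 ∈ v.primesAbove) :
    unramifiedKer (geomTorsion W n) 𝔓 ≤ selmerLocalKer W (v.adicCompletion K) n := by
  obtain ⟨𝔐, h𝔐⟩ := v.localPrimesAbove_nonempty
  obtain ⟨g, hg⟩ := HeightOneSpectrum.exists_smul_eq_of_mem_primesAbove_holds
    (HeightOneSpectrum.primeBelow_mem_primesAbove
      (ι := closureEmb (K := K) (v.adicCompletion K)) h𝔐) h𝔓
  have h1 : 𝔓 = v.primeBelow ((closureEmb (K := K) (v.adicCompletion K)).comp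
      ((show AlgebraicClosure K ≃ₐ[K] AlgebraicClosure K from g⁻¹) :
        AlgebraicClosure K →ₐ[K] AlgebraicClosure K)) 𝔐 := by
    rw [HeightOneSpectrum.primeBelow_comp, ← hg]
    exact congrArg (· • _) (inv_inv g).symm
  rw [h1, ← selmerLocalKer_eq_of_algHom_holds W (v.adicCompletion K) _ n]
  exact W.unramifiedKer_primeBelow_le_selmerLocalKerOfEmb_of_hasGoodReductionAt hv n _ h𝔐

/-- **Transport of unramified classes along a congruence, at ANY good place of `E`.** For elliptic
curves `E = W`, `E' = W'` over a number field `K`, a `Γ_K`-equivariant isomorphism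
`θ : E'[n] ⥲ E[n]`, a place `v` at which `E` has good reduction (nothing is asked of `E'`, nor
`v ∤ n`) and a prime `𝔓` above `v`: a class `c ∈ H¹(K, E'[n])` unramified at `𝔓` has
`θ_* c ∈ 𝓢_v(E) = selmerLocalKer W K_v n` (unramifiedness passes through `θ`,
`mem_unramifiedKer_iff_h1Equiv_mem`; then Milne I.3.8). This is the free part of the comparison of
local conditions at a place above `p` (the unramified third of the Kummer image transports).
[cite: MilneADT2006, Ch. I Prop. 3.8] -/
theorem h1Equiv_mem_selmerLocalKer_of_mem_unramifiedKer (W' : WeierstrassCurve K) {n : ℤ}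
    (θ : geomTorsion W' n ≃+ geomTorsion W n)
    (hθ : ∀ (σ : absoluteGaloisGroup K) (P : geomTorsion W' n), θ (σ • P) = σ • θ P)
    {v : HeightOneSpectrum (𝓞 K)} (hv : W.HasGoodReductionAt v)
    {𝔓 : Ideal (absIntegers (𝓞 K) K)} (h𝔓 : 𝔓 ∈ v.primesAbove)
    {c : galH1Torsion W' n} (hc : c ∈ unramifiedKer (geomTorsion W' n) 𝔓) :
    h1Equiv θ hθ c ∈ selmerLocalKer W (v.adicCompletion K) n :=
  W.unramifiedKer_le_selmerLocalKer_of_hasGoodReductionAt hv n h𝔓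
    ((mem_unramifiedKer_iff_h1Equiv_mem W W' θ hθ 𝔓 c).mp hc)

end WeierstrassCurve

end
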